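import Summits.BirchSwinnertonDyer.Rank1Residual.Partition.MainConjecturesIrreducibleIdentity
import Summits.BirchSwinnertonDyer.Rank1Residual.Partition.IrreducibleOverQuadraticField
import HarnessLib

/-!
# Rows C2, C16, C3 of the partition FROM PUBLISHED NAMED FACTS with NO Tamagawa proviso: the
# two-sided anticyclotomic main conjecture (BCS 2025 Thm. 1.2.4 (b) / Yan–Zhu 2026 Thm. 4.12) +
# JSW 2017 Thm. 3.3.1 ⇒ the Heegner-index identity over `K` ⇒ `BSD(E,p)` (cell `b2b-bsdres`, GLUE
# seat gen 9; row layer over `MainConjecturesIrreducibleIdentity.lean`)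

HONEST FRAMING (cell `b2b-bsdres`, run/shared/lean/b2b/bsd-rank1-residual/, verbatim in every
file): the goal of the cell is to DELETE the COMBINATION-SHAPED residual classes of the
Birch–Swinnerton-Dyer formula for ALL analytic-rank `≤ 1` elliptic curves over `ℚ` — "full BSD
formula for every rank `≤ 1` curve in class `C`" assembled STRICTLY from published theorems — so
that the rank-`≤ 1` remainder becomes exactly the CONSTRUCTION-SHAPED classes, which are TYPED
(missing-input `Prop`s), NOT attempted. This is not "finishing BSD". Research routes; no claim
beyond the stated classes; nothing booked; no label changes. THEOREMS ONLY (no definition, no named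
fact, no `sorry`); every published theorem enters as one of the tree's existing named Literature
facts BY NAME; every unproved / untyped-in-Literature statement enters as an EXPLICIT binder.

## What this file records

* §1 (datum level, the cleanest kernel objects of the finding)
  `X11b.indexIdentityAt_of_heegner_of_thm124b_of_thm331` — for `E/ℚ` globally minimal with
  `ord_{s=1} L(E,s) = 1`, `p > 3` good ordinary with `ρ̄_{E,p}` onto, and a classical Manin-unit
  Heegner datum over `K` (`d_K` odd `≠ −3`, every `ℓ ∣ N_E` and `p` split, `L(E^{d_K},1) ≠ 0`): the
  Heegner-index IDENTITY `2·ord_p ∏_ℓ c_ℓ(E) + ord_p #Ш(E/K) = 2·ord_p [E(K):ℤP_K]`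
  (`X11b.IndexIdentityAt`, = the `p`-part of BSD for `E/K` in Gross–Zagier's shape, Castella 2018
  (5.3)) FROM PUBLISHED NAMED FACTS ONLY: BCS 2025 Thm. 1.2.4 (b) ∘ CGLS 2022 Thm. 5.1.3 (`h124`),
  JSW 2017 Thm. 3.3.1 (`h331`), Gross–Zagier, Kolyvagin (rank/finiteness), GZK, modularity;
  (irred_𝒦) by `irrK_of_surj`. Its `p = 3` twin `…_of_thm412_of_thm331` (Yan–Zhu 4.12, (Im) at 3).
  NO hypothesis on the Tamagawa numbers.
* §2 the row theorems with NO Tamagawa binder, NO (irred_𝒦) binder, NO Kolyvagin index bound: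
  `RowC2.bsdp_of_publishedFacts_of_identityLink` (`r ≤ 1`), `RowC16.bsdp_of_publishedFacts_of_identityLink`
  (`r ≤ 1`), `RowC3.bsdp_of_publishedFacts_of_kobayashiMainConjecture_of_identityLink` (every prime of
  the row; the supersingular branch keeps the typed Kobayashi signed main conjecture `hKMC`, OPEN in
  print off CM / `a_p = 0`). Compared with gen 7's `RowC2/RowC16/RowC3.bsdp_of_publishedFacts…`:
  `−hB −htam0`; compared with gen 8's `…_of_jetchev[_optimalCurve]`: `−hJ −hopt −htam1 −hCassels`.

So the printed proofs of BCS Cor. 1.3.1 (p. 4), Yan–Zhu Thm. 4.15 (§4.6) and — on its ordinary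
branch, via BCS/YZ's two-sided IMC in place of Wan's divisibility + `K″` — JSW Thm. 1.2.1 are
kernel-checked at statement level on the rows' WHOLE loci, every input a named, cited Literature
fact, the ONLY non-fact binders being the row predicate and `r_an ≤ 1` (C2, C16) / `hKMC` (C3-ss).
Registry flags inherited, not decided here: `BCS25-IMC-equiv@BSTW` (T-BCS / A148) on every use of
BCS 2025; `BCS-124-XGr-reading`.

References: [BurungaleCastellaSkinner2025] Thm. 1.1.2 (b), Thm. 1.2.4 (b), Cor. 1.3.1 and its proof
(p. 4); [YanZhu2024MainConjNonCM] Thm. 4.9, 4.12, 4.15 (§4.6); [JetchevSkinnerWan2017] Thm. 1.2.1,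
Thm. 3.3.1, §7.4; [CastellaGrossiLeeSkinner2022] Thm. 5.1.3; [Castella2018] §5 (5.3); [GrossLMS1991]
Conj. (2.2); HOME/b2b-bsdres-lit-glue/GLUE.md GEN 9 ADDENDUM.
-/

set_option autoImplicit false

noncomputable section

open scoped Classical

open WeierstrassCurve NumberField IsDedekindDomain Literature.NumberTheory.EllipticCurves
  Literature.NumberTheory.EllipticCurves.ModularForms Literature.NumberTheory.Automorphic
  Literature.NumberTheory.EllipticCurves.Rank1Residual
  Literature.NumberTheory.EllipticCurves.YanZhu2026
  Literature.NumberTheory.EllipticCurves.BurungaleCastellaSkinner2025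
  Literature.NumberTheory.EllipticCurves.BurungaleKobayashiOta2024
  Literature.NumberTheory.EllipticCurves.CastellaGrossiLeeSkinner2022
  Literature.NumberTheory.EllipticCurves.JetchevSkinnerWan2017
  Summit.BirchSwinnertonDyer.BirchSwinnertonDyer.Theorems.Rank1ResidualX1Defs

namespace Summit.BirchSwinnertonDyer.Rank1Residual

/-! ### §1 The Heegner-index identity over `K` at a datum FROM PUBLISHED NAMED FACTS -/

namespace X11b

section Datum

variable (W : WeierstrassCurve ℚ) [W.IsElliptic] [W.IsGloballyMinimal] (p : ℕ) [Fact p.Prime]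
  (N : ℕ) [NeZero N] (K : Type) [Field K] [NumberField K]
  (Dt : ModularParametrizationData W N) (H : HeegnerDatum N (NumberField.discr K)) (ιC : K →+* ℂ)
  (P : (W.baseChange K).toAffine.Point)

/-- **The `p`-part of BSD for `E/K` in Gross–Zagier's shape — the Heegner-index identity
`2·ord_p ∏_ℓ c_ℓ(E) + ord_p #Ш(E/K) = 2·ord_p [E(K):ℤP_K]` — FROM PUBLISHED NAMED FACTS, with NO
hypothesis on the Tamagawa numbers**, at every classical Manin-unit Heegner datum of a pair `(E, p)`
with `ord_{s=1} L(E,s) = 1`, `p > 3` good ordinary, `ρ̄_{E,p}` surjective: BCS 2025 Thm. 1.2.4 (b) ∘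
CGLS 2022 Thm. 5.1.3 (`h124`, the TWO-SIDED anticyclotomic IMC at `𝟙`) + JSW 2017 Thm. 3.3.1
(`h331`, control) through the σ-bridge (`imcWaldspurgerOnTreeGoodAt_inducedPlace_of_thm124b_of_thm331`,
`controlOnTreeGoodAt_of_thm331_of_inducedPlace`) and gen 3's bookkeeping
`indexIdentityAt_of_onTreeGoodLinks_of_allSplit`; rank one and finiteness over `K` by GZK + descent
and Kolyvagin (`hKo`), `P_K` non-torsion by Gross–Zagier (`hGZ`), (irred_𝒦) by `irrK_of_surj`. This
is "the `p`-part of the Birch–Swinnerton-Dyer formula for `E/K`" of BCS's proof of Cor. 1.3.1 (p. 4).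
[cite: BurungaleCastellaSkinner2025, Thm. 1.2.4 (b), proof of Cor. 1.3.1 (p. 4)]
[cite: JetchevSkinnerWan2017, Thm. 3.3.1 with §3.5 (3.5.d), §7.3.1 (eq:tamK)]
[cite: CastellaGrossiLeeSkinner2022, Thm. 5.1.3] [cite: Castella2018, §5 (5.3) (arXiv:1704.06608 p. 12)]
[cite: GrossLMS1991, §2 Conj. (2.2)] [cite: Kolyvagin1990, Thm. A] -/
theorem indexIdentityAt_of_heegner_of_thm124b_of_thm331
    (h124 : thm124b_thm513_generator_constantCoeff) (h331 : thm331_anticyclotomicControl)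
    (hGZ : gross_zagier N W K) (hKo : kolyvagin N W K) (hmod : hasEntireLFunction_rat)
    (hGZK : rank_eq_analyticRank_of_analyticRank_le_one)
    (hp : 3 < p) (hord : GoodOrd W p) (hsurj : Surj W p) (hr : W.analyticRank = 1)
    (hN : W.conductorNorm ℤ = N) (hK : IsImaginaryQuadratic K) (hodd : Odd (NumberField.discr K))
    (h3 : NumberField.discr K ≠ -3) (hHN : SatisfiesHeegnerHypothesis N K)
    (hHp : SatisfiesHeegnerHypothesis p K)
    (hLt : (W.quadraticTwist (NumberField.discr K : ℚ)).entireLFunction 1 ≠ 0)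
    (hP : WeierstrassCurve.Affine.Point.map ιC.toRatAlgHom P = heegnerPointComplex Dt H)
    (hc : ¬ (p : ℤ) ∣ Dt.c) : IndexIdentityAt W p K P := by
  haveI : Finite (W.baseChange K).sha :=
    finite_sha_baseChange_of_heegner W N K Dt H ιC P hGZ hKo hmod hr hK hHN hLt hP
  obtain ⟨hrQ, hShaQ⟩ := hGZK W hr.le
  rw [hr] at hrQ
  obtain ⟨hrk, hfinp⟩ :=
    mordellWeilRank_baseChange_eq_one_and_finite_sha_of_twist_L_one_ne_zero hGZK W K hK p hrQ hShaQ hLt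
  have hPinf : ¬ IsOfFinAddOrder P :=
    not_isOfFinAddOrder_of_heegner_of_analyticRank_eq_one W N K Dt H ιC P hGZ hmod hr hK hHN hLt hP
  have hirrK : (W.baseChange K).HasIrreducibleModPGaloisRep p := irrK_of_surj W p hsurj K hK.1
  obtain ⟨κ, γ, 𝔭, hκ, hγ, h𝔭⟩ := exists_anticyclotomic_generator_prime (p := p) hK
  haveI : Fact (κ.IsTopGenerator γ) := ⟨hγ⟩
  have hsplit : SplitsIn K p := hHp p Fact.out (dvd_refl p)
  obtain ⟨he, hf⟩ := degreeOne_of_splitsIn hK.1 hsplit h𝔭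
  set ι : K →+* ℚ_[p] := embAt K p 𝔭 h𝔭 he hf with hι
  have hCTL : ControlOnTreeGoodAt p κ (inducedPlace ι) γ ι P :=
    controlOnTreeGoodAt_of_thm331_of_inducedPlace h331 (by omega) hord.1 hK hHp hN hHN hirrK ι κ hκ γ
      hrk hfinp P hPinf
  have hIW : IMCWaldspurgerOnTreeGoodAt p κ (inducedPlace ι) γ ι P :=
    imcWaldspurgerOnTreeGoodAt_inducedPlace_of_thm124b_of_thm331 h124 h331 hp hord hsurj hK hodd h3 hN
      hHN hHp hirrK ι κ hκ γ Dt hc H ιC P hP hrk hfinp hPinf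
  exact indexIdentityAt_of_onTreeGoodLinks_of_allSplit hK hN hHN hIW hCTL

/-- **The same identity at `p = 3`** (good ordinary, `ρ̄_{E,3}` surjective, hence (Im) at `3` by
Wuthrich 2014 Lemma 20 `hW20`): Yan–Zhu 2026 Thm. 4.12 ∘ CGLS 5.1.3 (`h412`) + JSW 3.3.1 (`h331`).
[cite: YanZhu2024MainConjNonCM, Thm. 4.12, proof of Thm. 4.15 (§4.6)]
[cite: JetchevSkinnerWan2017, Thm. 3.3.1] [cite: Wuthrich2014, Lemma 20 (p. 399)] [cite: GrossLMS1991, §2 Conj. (2.2)] -/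
theorem indexIdentityAt_of_heegner_of_thm412_of_thm331
    (h412 : thm412_thm513_generator_constantCoeff) (h331 : thm331_anticyclotomicControl)
    (hW20 : Wuthrich2014.lemma20_surjective_threeAdic_of_semistable)
    (hGZ : gross_zagier N W K) (hKo : kolyvagin N W K) (hmod : hasEntireLFunction_rat)
    (hGZK : rank_eq_analyticRank_of_analyticRank_le_one)
    (hp : p = 3) (hord : GoodOrd W p) (hsurj : Surj W p) (hr : W.analyticRank = 1)
    (hN : W.conductorNorm ℤ = N) (hK : IsImaginaryQuadratic K) (hodd : Odd (NumberField.discr K))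
    (h3 : NumberField.discr K ≠ -3) (hHN : SatisfiesHeegnerHypothesis N K)
    (hHp : SatisfiesHeegnerHypothesis p K)
    (hLt : (W.quadraticTwist (NumberField.discr K : ℚ)).entireLFunction 1 ≠ 0)
    (hP : WeierstrassCurve.Affine.Point.map ιC.toRatAlgHom P = heegnerPointComplex Dt H)
    (hc : ¬ (p : ℤ) ∣ Dt.c) : IndexIdentityAt W p K P := by
  subst hp
  haveI : Finite (W.baseChange K).sha :=
    finite_sha_baseChange_of_heegner W N K Dt H ιC P hGZ hKo hmod hr hK hHN hLt hP
  obtain ⟨hrQ, hShaQ⟩ := hGZK W hr.le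
  rw [hr] at hrQ
  obtain ⟨hrk, hfinp⟩ :=
    mordellWeilRank_baseChange_eq_one_and_finite_sha_of_twist_L_one_ne_zero hGZK W K hK 3 hrQ hShaQ hLt
  have hPinf : ¬ IsOfFinAddOrder P :=
    not_isOfFinAddOrder_of_heegner_of_analyticRank_eq_one W N K Dt H ιC P hGZ hmod hr hK hHN hLt hP
  have hirrK : (W.baseChange K).HasIrreducibleModPGaloisRep 3 := irrK_of_surj W 3 hsurj K hK.1
  have him : BigIm W 3 := X9.bigIm_three_of_surj W hW20 (Or.inl hord.1) hsurj
  obtain ⟨κ, γ, 𝔭, hκ, hγ, h𝔭⟩ := exists_anticyclotomic_generator_prime (p := 3) hK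
  haveI : Fact (κ.IsTopGenerator γ) := ⟨hγ⟩
  have hsplit : SplitsIn K 3 := hHp 3 Fact.out (dvd_refl 3)
  obtain ⟨he, hf⟩ := degreeOne_of_splitsIn hK.1 hsplit h𝔭
  set ι : K →+* ℚ_[3] := embAt K 3 𝔭 h𝔭 he hf with hι
  have hCTL : ControlOnTreeGoodAt 3 κ (inducedPlace ι) γ ι P :=
    controlOnTreeGoodAt_of_thm331_of_inducedPlace h331 le_rfl hord.1 hK hHp hN hHN hirrK ι κ hκ γ hrk
      hfinp P hPinf
  have hIW : IMCWaldspurgerOnTreeGoodAt 3 κ (inducedPlace ι) γ ι P :=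
    imcWaldspurgerOnTreeGoodAt_inducedPlace_of_thm412_of_thm331 h412 h331 le_rfl hord him hK hodd h3 hN
      hHN hHp hirrK ι κ hκ γ Dt hc H ιC P hP hrk hfinp hPinf
  exact indexIdentityAt_of_onTreeGoodLinks_of_allSplit hK hN hHN hIW hCTL

end Datum

end X11b

/-! ### §2 The rows with NO Tamagawa binder -/

section Rows

variable (W : WeierstrassCurve ℚ) [W.IsElliptic] [W.IsGloballyMinimal] (p : ℕ) [Fact p.Prime]

/-- **Row C2 (`r ≤ 1`: `¬cm`, `p > 3` good ordinary, (irr), (im)) FROM PUBLISHED NAMED FACTS, the ONLY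
non-fact binders being the row predicate and `r_an ≤ 1`** — gen 7's `RowC2.bsdp_of_publishedFacts`
with Kolyvagin's index bound `hB` and the Tamagawa proviso `htam0` GONE. Rank `0`: BCS Thm. 1.1.2
(b) + Greenberg 4.1 (`RowC2.bsdp_rankZero_of_bcsThm112b`). Rank `1`: the identity form
(`bsdp_rankOne_of_thm331_of_columnMainConjecture_odd_of_identityLink`) with the column MC = BCS
Thm. 1.1.2 (b) (`hBCS`), (im) ⇐ surj (`X9.bigIm_of_surj`, `p ≥ 5`), (irred_𝒦) ⇐ (sur)
(`irrK_of_surj`), and the TWO-SIDED anticyclotomic link from BCS Thm. 1.2.4 (b) ∘ CGLS 5.1.3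
(`h124`) + JSW 3.3.1 (`h331`) (`X11b.imcWaldspurgerOnTreeGoodAt_inducedPlace_of_thm124b_of_thm331`).
Inputs otherwise: Gross–Zagier, Kolyvagin (rank/finiteness), GZK, Greenberg 4.1, modularity,
Hoffstein–Luo / BFH, Mazur (Manin), Néron scaling — all named facts. This is the printed proof of
BCS 2025 Cor. 1.3.1 (p. 4), kernel-checked at statement level on the row's WHOLE locus.
[cite: BurungaleCastellaSkinner2025, Thm. 1.1.2 (b), Thm. 1.2.4 (b), Cor. 1.3.1 and its proof (p. 4)]
[cite: JetchevSkinnerWan2017, Thm. 3.3.1] [cite: CastellaGrossiLeeSkinner2022, Thm. 5.1.3]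
[cite: Miller2011LMS, Def. 1.1] -/
theorem RowC2.bsdp_of_publishedFacts_of_identityLink
    (hGZ : ∀ (N : ℕ) [NeZero N] (W : WeierstrassCurve ℚ) (K : Type) [Field K] [NumberField K],
      gross_zagier N W K)
    (hKo : ∀ (N : ℕ) [NeZero N] (W : WeierstrassCurve ℚ) (K : Type) [Field K] [NumberField K],
      kolyvagin N W K)
    (hBCS : thm112b_charIdeal_eq_padicLFunction_integral) (h331 : thm331_anticyclotomicControl)
    (h124 : thm124b_thm513_generator_constantCoeff)
    (hGr : greenberg_charValue_rankZero) (hGZK : rank_eq_analyticRank_of_analyticRank_le_one)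
    (hmod : hasEntireLFunction_rat) (hpar : nonempty_modularParametrizationData)
    (hnf : exists_isNewformOf) (hHL : HoffsteinLuo1997_exists_twist_L_one_ne_zero)
    (hMaz : mazur_not_dvd_maninConstant_of_odd) (hNS : integral_neronScaling_of_isGloballyMinimal)
    (h : RowC2 W p) (hr : W.analyticRank ≤ 1) :
    BSDp W p := by
  have hp : 3 < p := h.2.1
  have hp5 : 5 ≤ p := (Fact.out : p.Prime).five_le_of_ne_two_of_ne_three (by omega) (by omega)
  have hsurj : Surj W p := surj_of_irr_of_bigIm W p h.2.2.2.1 h.2.2.2.2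
  rcases Nat.lt_or_ge W.analyticRank 1 with h0 | h1
  · exact RowC2.bsdp_rankZero_of_bcsThm112b hBCS hGr hpar hGZK h (by omega)
  · have hr1 : W.analyticRank = 1 := le_antisymm hr h1
    refine bsdp_rankOne_of_thm331_of_columnMainConjecture_odd_of_identityLink hGZ hKo h331 hGr hGZK
      hmod hpar hnf hHL hMaz hNS W p (by omega) h.2.2.1 hsurj hr1
      (fun V _ _ hordV hirrV himV ↦ hBCS V p hp hordV hirrV himV)
      (fun V _ _ _ hsV ↦ X9.bigIm_of_surj V p hp5 hsV)
      (fun K _ _ hK _ _ ↦ irrK_of_surj W p hsurj K hK.1) ?_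
    intro N _ K _ _ Dt H ιC P hN hK hodd hlt hHN hHp _ hP hc hirrK hrk hfinp hPinf κ hκ γ _ ι
    exact X11b.imcWaldspurgerOnTreeGoodAt_inducedPlace_of_thm124b_of_thm331 h124 h331 hp h.2.2.1 hsurj
      hK hodd (by omega) hN hHN hHp hirrK ι κ hκ γ Dt hc H ιC P hP hrk hfinp hPinf

/-- **Row C16 (`r ≤ 1`: `p = 3` good ordinary, (irr), surj(3) ∨ ram(3)) FROM PUBLISHED NAMED FACTS,
the ONLY non-fact binders being the row predicate and `r_an ≤ 1`** — gen 7's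
`RowC16.bsdp_of_publishedFacts` with `hB` and `htam0` GONE. Rank `0`: Yan–Zhu Thm. 4.9
(`RowC16.bsdp_rankZero_of_yzThm49`). Rank `1`: the identity form with the column MC = Yan–Zhu
Thm. 4.9 (`hYZ`), (Im) at `3` ⇐ surj (Wuthrich L. 20 `hW20`), ram(3) ⇒ surj(3)
(`surj_of_irr_of_ram`), (irred_𝒦) ⇐ (sur), and the TWO-SIDED link from Yan–Zhu Thm. 4.12 ∘ CGLS
5.1.3 (`h412`) + JSW 3.3.1 (`X11b.imcWaldspurgerOnTreeGoodAt_inducedPlace_of_thm412_of_thm331`). The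
printed proof of Yan–Zhu 2026 Thm. 4.15 at `p = 3` (§4.6), kernel-checked at statement level on the
row's WHOLE locus. [cite: YanZhu2024MainConjNonCM, Thm. 4.9, Thm. 4.12, Thm. 4.15 and its proof (§4.6)]
[cite: JetchevSkinnerWan2017, Thm. 3.3.1] [cite: Wuthrich2014, Lemma 20 (p. 399)] [cite: Miller2011LMS, Def. 1.1] -/
theorem RowC16.bsdp_of_publishedFacts_of_identityLink
    (hGZ : ∀ (N : ℕ) [NeZero N] (W : WeierstrassCurve ℚ) (K : Type) [Field K] [NumberField K],
      gross_zagier N W K)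
    (hKo : ∀ (N : ℕ) [NeZero N] (W : WeierstrassCurve ℚ) (K : Type) [Field K] [NumberField K],
      kolyvagin N W K)
    (hYZ : thm49_charIdeal_eq_padicLFunction_integral)
    (hW20 : Wuthrich2014.lemma20_surjective_threeAdic_of_semistable)
    (h331 : thm331_anticyclotomicControl) (h412 : thm412_thm513_generator_constantCoeff)
    (hGr : greenberg_charValue_rankZero) (hGZK : rank_eq_analyticRank_of_analyticRank_le_one)
    (hmod : hasEntireLFunction_rat) (hpar : nonempty_modularParametrizationData)
    (hnf : exists_isNewformOf) (hHL : HoffsteinLuo1997_exists_twist_L_one_ne_zero)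
    (hMaz : mazur_not_dvd_maninConstant_of_odd) (hNS : integral_neronScaling_of_isGloballyMinimal)
    (h : RowC16 W p) (hr : W.analyticRank ≤ 1) :
    BSDp W p := by
  rcases Nat.lt_or_ge W.analyticRank 1 with h0 | h1
  · exact RowC16.bsdp_rankZero_of_yzThm49 hYZ hW20 hGr hpar hGZK h (by omega)
  · have hr1 : W.analyticRank = 1 := le_antisymm hr h1
    obtain ⟨hp3, hord, hirr, hsr⟩ := h
    have hsurj : Surj W p := hsr.elim id fun hram ↦ surj_of_irr_of_ram W p hirr hram
    subst hp3
    have him3 : ∀ (V : WeierstrassCurve ℚ) [V.IsElliptic] [V.IsGloballyMinimal],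
        GoodOrd V 3 → Surj V 3 → BigIm V 3 :=
      fun V _ _ hordV hsV ↦ X9.bigIm_three_of_surj V hW20 (Or.inl hordV.1) hsV
    refine bsdp_rankOne_of_thm331_of_columnMainConjecture_odd_of_identityLink hGZ hKo h331 hGr hGZK
      hmod hpar hnf hHL hMaz hNS W 3 le_rfl hord hsurj hr1
      (fun V _ _ hordV hirrV himV ↦ hYZ V 3 le_rfl hordV hirrV himV) him3
      (fun K _ _ hK _ _ ↦ irrK_of_surj W 3 hsurj K hK.1) ?_
    intro N _ K _ _ Dt H ιC P hN hK hodd hlt hHN hHp _ hP hc hirrK hrk hfinp hPinf κ hκ γ _ ι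
    exact X11b.imcWaldspurgerOnTreeGoodAt_inducedPlace_of_thm412_of_thm331 h412 h331 le_rfl hord
      (him3 W hord hsurj) hK hodd (by omega) hN hHN hHp hirrK ι κ hκ γ Dt hc H ιC P hP hrk hfinp hPinf

/-- **Row C3 (= JSW 2017 Thm. 1.2.1) at every prime of the row, the whole ORDINARY branch FROM
PUBLISHED NAMED FACTS with NO Tamagawa proviso** — gen 7's
`RowC3.bsdp_of_publishedFacts_of_kobayashiMainConjecture` with `hB` and `htam0` GONE. Ordinary
(`p ∤ a_p`): the identity form with the column MC = BCS Thm. 1.1.2 (b) (`p ≥ 5`) / Yan–Zhu Thm. 4.9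
(`p = 3`), (sur) from Diamond's refined Serre (`RowC3.surj`), (im) ⇐ surj (`X9.bigIm_of_surj` /
Wuthrich L. 20), (irred_𝒦) ⇐ (sur), and the TWO-SIDED link from BCS 1.2.4 (b) ∘ CGLS 5.1.3 (`p > 3`) /
Yan–Zhu 4.12 ∘ CGLS 5.1.3 (`p = 3`) + JSW 3.3.1. Supersingular (`p ∣ a_p`) unchanged: the typed
Kobayashi signed main conjecture (`hKMC`, OPEN in print off CM / `a_p = 0`) + BKO 2024 Cor. A.5
(`hA5`). On the ordinary branch this REPLACES JSW's printed §7.4 route (Wan's one divisibility over `K′`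
+ Kolyvagin over `K″` on `X_{N⁺,N⁻}`) by BCS/Yan–Zhu's two-sided IMC over one classical `K` — both
routes are published; the tree vendors the second.
[cite: JetchevSkinnerWan2017, Thm. 1.2.1, Thm. 3.3.1, §7.4] [cite: BurungaleCastellaSkinner2025, Thm. 1.1.2 (b), Thm. 1.2.4 (b)]
[cite: YanZhu2024MainConjNonCM, Thm. 4.9, Thm. 4.12] [cite: BurungaleKobayashiOta2023, App. A Cor. A.5]
[cite: Wuthrich2014, Lemma 20 (p. 399)] [cite: Miller2011LMS, Def. 1.1] -/
theorem RowC3.bsdp_of_publishedFacts_of_kobayashiMainConjecture_of_identityLink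
    (hGZ : ∀ (N : ℕ) [NeZero N] (W : WeierstrassCurve ℚ) (K : Type) [Field K] [NumberField K],
      gross_zagier N W K)
    (hKo : ∀ (N : ℕ) [NeZero N] (W : WeierstrassCurve ℚ) (K : Type) [Field K] [NumberField K],
      kolyvagin N W K)
    (hBCS : thm112b_charIdeal_eq_padicLFunction_integral)
    (hYZ : thm49_charIdeal_eq_padicLFunction_integral)
    (hW20 : Wuthrich2014.lemma20_surjective_threeAdic_of_semistable)
    (h331 : thm331_anticyclotomicControl) (h124 : thm124b_thm513_generator_constantCoeff)
    (h412 : thm412_thm513_generator_constantCoeff)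
    (hA5 : corA5_pPart_of_signedCharIdeal_eq)
    (hGr : greenberg_charValue_rankZero) (hGZK : rank_eq_analyticRank_of_analyticRank_le_one)
    (hmod : hasEntireLFunction_rat) (hpar : nonempty_modularParametrizationData)
    (hnf : exists_isNewformOf) (hLL : diamond1995_refinedSerre)
    (hHL : HoffsteinLuo1997_exists_twist_L_one_ne_zero)
    (hMaz : mazur_not_dvd_maninConstant_of_odd) (hNS : integral_neronScaling_of_isGloballyMinimal)
    (h : RowC3 W p)
    (ε : ℤˣ) (hKMC : (p : ℤ) ∣ W.frobeniusTrace p → Supersingular.KobayashiMainConjecture W p ε) :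
    BSDp W p := by
  by_cases hdvd : (p : ℤ) ∣ W.frobeniusTrace p
  · -- supersingular: typed Kobayashi MC (one sign) + BKO Cor. A.5
    exact RowC3.bsdp_rankOne_ss_of_kobayashiMainConjecture_of_corA5 hA5 hmod hGZK h hdvd ε (hKMC hdvd)
  · -- ordinary (anomalous allowed): everything published, NO Tamagawa proviso
    have hord : GoodOrd W p := ⟨h.2.2.1, hdvd⟩
    have hp : 5 ≤ p ∨ p = 3 ∧ (GoodOrd W p ∨ W.frobeniusTrace 3 = 0) := h.2.2.2.2
    have hp3 : 3 ≤ p := by rcases hp with h5 | ⟨h3, -⟩ <;> omega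
    have hsurj : Surj W p := RowC3.surj hnf hLL h
    have hIm : ∀ (V : WeierstrassCurve ℚ) [V.IsElliptic] [V.IsGloballyMinimal],
        GoodOrd V p → Surj V p → BigIm V p := by
      intro V _ _ hordV hsV
      by_cases h5 : 5 ≤ p
      · exact X9.bigIm_of_surj V p h5 hsV
      · have h3 : p = 3 := by rcases hp with h | ⟨h, -⟩ <;> omega
        subst h3
        exact X9.bigIm_three_of_surj V hW20 (Or.inl hordV.1) hsV
    refine bsdp_rankOne_of_thm331_of_columnMainConjecture_odd_of_identityLink hGZ hKo h331 hGr hGZK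
      hmod hpar hnf hHL hMaz hNS W p hp3 hord hsurj h.1 ?_ hIm
      (fun K _ _ hK _ _ ↦ irrK_of_surj W p hsurj K hK.1) ?_
    · intro V _ _ hordV hirrV himV
      by_cases h5 : 5 ≤ p
      · exact hBCS V p (by omega) hordV hirrV himV
      · have h3 : p = 3 := by rcases hp with h | ⟨h, -⟩ <;> omega
        subst h3
        exact hYZ V 3 le_rfl hordV hirrV himV
    · intro N _ K _ _ Dt H ιC P hN hK hodd hlt hHN hHp _ hP hc hirrK hrk hfinp hPinf κ hκ γ _ ι
      by_cases h5 : 3 < p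
      · exact X11b.imcWaldspurgerOnTreeGoodAt_inducedPlace_of_thm124b_of_thm331 h124 h331 h5 hord hsurj
          hK hodd (by omega) hN hHN hHp hirrK ι κ hκ γ Dt hc H ιC P hP hrk hfinp hPinf
      · have h3 : p = 3 := by rcases hp with h | ⟨h, -⟩ <;> omega
        subst h3
        exact X11b.imcWaldspurgerOnTreeGoodAt_inducedPlace_of_thm412_of_thm331 h412 h331 le_rfl hord
          (hIm W hord hsurj) hK hodd (by omega) hN hHN hHp hirrK ι κ hκ γ Dt hc H ιC P hP hrk hfinp
          hPinf

end Rows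

end Summit.BirchSwinnertonDyer.Rank1Residual

end
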